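import Literature.AlgebraicGeometry.Frobenioids.BaseSquareUniqueness
import HarnessLib

/-!
# Frobenioids I, Corollary 4.11 (ii) — "composing diagrams": the base square of `Ψ` from a tower
# `C_i → U_i → D_i` factoring `Base_i` and a base square at the level `U_i`

Mochizuki, *The geometry of Frobenioids I: the general theory*, Kyushu J. Math. **62** (2008)
293–400, kurims text proof of Cor. 4.11 (ii) pp. 93–94: `Ψ` induces `Ψ^birat : C₁^birat ⥲ C₂^birat`
(Cor. 4.10), then `(Ψ^birat)^un-tr`, and "since the Frobenioids `(C_i^birat)^un-tr` are of isotropic,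
unit-trivial and group-like type … we obtain a 1-commutative diagram [`(Ψ^birat)^un-tr` over `Ψ^Base`,
cf. Proposition 3.11, (iii)]. Thus, by composing diagrams, we obtain a 1-commutative diagram as in the
statement of assertion (ii), which is easily verified to be 1-unique" [cite: MochizukiFrdI2008, Cor. 4.11 (ii) p.94].

PROOF-ONLY companion of `DivisorMonoidCategoryTheoreticity.lean` (seat abc-iut-L1-t3), generic over
`S_i : PreFrobenioidData C_i D_i`. The tower `C_i → C_i^birat → (C_i^birat)^un-tr → D_i` is abstracted as
functors `T_i : C_i ⥤ U_i` with operations `SU_i` on `U_i` over `D_i` whose base functor factors `Base_i`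
(`T_i ⋙ SU_i.base ≅ S_i.base`), an equivalence `Ψ^U : U₁ ⥲ U₂` `1`-commuting with `Ψ` over the `T_i`, and
a base square for `Ψ^U` (the conclusion of Prop. 3.11 (iii) at the level `U_i`):

* `oneCommutes_base_of_tower`: the pasted `1`-commutation `Base₂ ∘ Ψ ≅ Ψ^Base ∘ Base₁`;
* `cor411ii_of_tower`: hence — with the `1`-uniqueness transfer of `BaseSquareUniqueness.lean` under
  Def. 1.3 (i)(a)(b)(c) of `C₁ → D₁` and the rigidity of `Base₂ ∘ Ψ` on slim bases (Prop. 1.13 (i)) — the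
  typed Cor. 4.11 (ii). The mathematical inputs of the printed passage (Cor. 4.10; "`Ψ^birat` preserves
  base-identity endomorphisms", Prop. 4.4 (iv) + Thm. 4.2 (ii) + Div-slimness; Prop. 3.11 (iii)) are
  exactly what produces `Ψ^U` and its base square; they are inputs here.

No statement of the paper is strengthened; nothing here is specific to the abc programme.
-/

namespace Literature.AlgebraicGeometry.Frobenioids

open CategoryTheory Opposite

universe w₁ w₂ w₃ w₄ v₁ v₁' v₂ v₂' v₃ v₄ u₁ u₁' u₂ u₂' u₃ u₄

namespace PreFrobenioidData

section Tower

variable {C₁ : Type u₁} [Category.{v₁} C₁] {D₁ : Type u₁'} [Category.{v₁'} D₁]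
variable {C₂ : Type u₂} [Category.{v₂} C₂] {D₂ : Type u₂'} [Category.{v₂'} D₂]
variable {U₁ : Type u₃} [Category.{v₃} U₁] {U₂ : Type u₄} [Category.{v₄} U₂]
variable (S₁ : PreFrobenioidData.{w₁} C₁ D₁) (S₂ : PreFrobenioidData.{w₂} C₂ D₂) (Ψ : C₁ ≌ C₂)
variable (SU₁ : PreFrobenioidData.{w₃} U₁ D₁) (SU₂ : PreFrobenioidData.{w₄} U₂ D₂)

/-- "By composing diagrams" (FrdI proof of Cor. 4.11 (ii) p. 94): if `Base_i` factors as
`C_i → U_i → D_i` (`T_i ⋙ SU_i.base ≅ S_i.base`), `Ψ^U : U₁ ⥲ U₂` `1`-commutes with `Ψ` over the `T_i`, and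
`Ψ^Base` `1`-commutes with `Ψ^U` over the base functors of the `U_i`, then `Ψ^Base` `1`-commutes with `Ψ`
over `Base₁`, `Base₂`. [cite: MochizukiFrdI2008, Cor. 4.11 (ii) p.94] -/
theorem oneCommutes_base_of_tower (T₁ : C₁ ⥤ U₁) (T₂ : C₂ ⥤ U₂) (ι₁ : T₁ ⋙ SU₁.base ≅ S₁.base)
    (ι₂ : T₂ ⋙ SU₂.base ≅ S₂.base) (ΨU : U₁ ⥤ U₂) (hT : OneCommutes Ψ.functor T₂ T₁ ΨU)
    (ΨBase : D₁ ⥤ D₂) (hU : OneCommutes ΨU SU₂.base SU₁.base ΨBase) :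
    OneCommutes Ψ.functor S₂.base S₁.base ΨBase := by
  obtain ⟨τ⟩ := hT
  obtain ⟨σ⟩ := hU
  exact ⟨Functor.isoWhiskerLeft Ψ.functor ι₂.symm ≪≫ (Functor.associator _ _ _).symm ≪≫
    Functor.isoWhiskerRight τ SU₂.base ≪≫ Functor.associator _ _ _ ≪≫ Functor.isoWhiskerLeft T₁ σ ≪≫
    (Functor.associator _ _ _).symm ≪≫ Functor.isoWhiskerRight ι₁ ΨBase⟩

/-- **Corollary 4.11 (ii) from the tower** (FrdI proof of Cor. 4.11 (ii) pp. 93–94): under Def. 1.3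
(i)(a)(b)(c) of `C₁ → D₁` (operations form), if `Base_i` factors through `T_i : C_i → U_i` (print:
`C_i → C_i^birat → (C_i^birat)^un-tr`), `Ψ` induces an equivalence `Ψ^U : U₁ ⥲ U₂` over the `T_i` (print:
`(Ψ^birat)^un-tr`, from Cor. 4.10 and the preservation of base-identity endomorphisms), and `Ψ^U` admits
a `1`-commuting equivalence of base categories (print: Prop. 3.11 (iii) for the Frobenioids
`(C_i^birat)^un-tr` of isotropic, unit-trivial and group-like type), then the typed Cor. 4.11 (ii) holds
for `Ψ` — the rigidity of `Base₂ ∘ Ψ` on slim bases (Prop. 1.13 (i)) being the remaining input.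
[cite: MochizukiFrdI2008, Cor. 4.11 (ii) p.91] -/
theorem cor411ii_of_tower
    (hbase : ∀ X : D₁, ∃ A : C₁, Nonempty (S₁.base.obj A ≅ X))
    (hconn : ∀ (A B : C₁) (g : S₁.base.obj A ≅ S₁.base.obj B), ∃ (X : C₁) (φ : X ⟶ A) (ψ : X ⟶ B),
      IsIso (S₁.base.map φ) ∧ S₁.base.map φ ≫ g.hom = S₁.base.map ψ)
    (hpb : ∀ (A : C₁) {Y : D₁} (f : Y ⟶ S₁.base.obj A),
      ∃ (A' : C₁) (φ : A' ⟶ A) (e : S₁.base.obj A' ≅ Y), S₁.base.map φ = e.hom ≫ f)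
    (T₁ : C₁ ⥤ U₁) (T₂ : C₂ ⥤ U₂) (ι₁ : T₁ ⋙ SU₁.base ≅ S₁.base) (ι₂ : T₂ ⋙ SU₂.base ≅ S₂.base)
    (ΨU : U₁ ⥤ U₂) (hT : OneCommutes Ψ.functor T₂ T₁ ΨU)
    (hU : ∃ ΨBase : D₁ ⥤ D₂, OneUniqueSquare ΨU SU₁.base SU₂.base ΨBase)
    (hrig : IsSlim D₁ → IsSlim D₂ → IsRigidFunctor (Ψ.functor ⋙ S₂.base)) : Cor411ii S₁ S₂ Ψ := by
  obtain ⟨ΨBase, hEq, hsq, -⟩ := hU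
  exact cor411ii_of_exists_base_equivalence S₁ S₂ Ψ hbase hconn hpb
    ⟨ΨBase, hEq, oneCommutes_base_of_tower S₁ S₂ Ψ SU₁ SU₂ T₁ T₂ ι₁ ι₂ ΨU hT ΨBase hsq⟩ hrig

end Tower

end PreFrobenioidData

end Literature.AlgebraicGeometry.Frobenioids
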